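import Literature.Probability.RandomPlanarGeometry.SAWPatternDensity
import Literature.Probability.RandomPlanarGeometry.SAWWords
import Literature.Probability.RandomPlanarGeometry.SAWBridges
import Mathlib.Analysis.SpecialFunctions.Log.Basic
import HarnessLib

/-!
# The bending energy of self-avoiding walks on `ℤ²`: turn counts, `Z_N(t)`, and the free energy `κ(t)`

Topic `Literature/Probability/RandomPlanarGeometry` (continues `SAWPatternDensity.lean` (`Zd.occ`, event families at the
steps of a walk), `SAWWords.lean` (step words, `traj`, `sawWords`, the bijection `image_traj_sawWords`) and
`SAWBridges.lean`).

Semi-flexible (persistence-weighted) self-avoiding walks: each walk `ω ∈ S_N` is weighted by `t^{turns(ω)}`, where a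
TURN at step `j` means that the steps `j → j+1` and `j+1 → j+2` differ. Source for the model: N. Madras, G. Slade,
*The Self-Avoiding Walk* (1993), §2.1 (variants of the self-avoiding walk; the weights here are the standard
"stiffness"/bending fugacity); the objects below are the planner's typed objects of the lane «pcv-sawmu» route «STIFF»
(a-idea-2 gen 8, `Sketch_v7.lean` d87c31580ac19fbc, bodies VERBATIM).

## Contents (namespace `Literature.Probability.RandomPlanarGeometry.SAW`; all proved, standard axioms)

* `Zd.turnAt`, `Zd.turns N ω` (`= Zd.occ turnAt`), `Zd.Zbend N t = Σ_{ω ∈ S_N} t^{turns}`, `Zd.ZbendB` (bridges),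
  `Zd.bendFE t = ⨅_N log(max(1,t) Z_{N+1}(t))/(N+1)` (the bending free energy `κ(t)` in Fekete form);
* word side: `wturns w` (number of letter changes), the dictionary `occ_turnAt_traj` / `turns_traj`
  (`turns N (traj w) = wturns w`), and **`Zbend_eq_sum_sawWords`**: `Z_N(t) = Σ_{w ∈ sawWords N} t^{wturns w}`.

The partially-directed lower bound `(1+√2)(1+√2 t)^{N-1} ≤ Z_N(t)` and its consequences `κ(t) ≥ log(1 + √2 t)`,
`liminf κ(t)/t ≥ √2` are in `SAWBendingEnergyPDLower.lean`.
-/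

noncomputable section

open Finset Filter Topology
open scoped BigOperators
open Literature.Probability.LatticeModels

namespace Literature.Probability.RandomPlanarGeometry.SAW

namespace Zd

/-! ### Objects (bodies verbatim from the planner's `Sketch_v7.lean`) -/

/-- A **turn** at step `j` of the `N`-step walk `ω`: steps `j → j+1` and `j+1 → j+2` differ
(on a self-avoiding walk they are then perpendicular). Event family in the format of `Zd.hairpinAt`.
[cite: MadrasSlade1993, §2.1 (semi-flexible / persistence-weighted walks)] -/
def turnAt {d : ℕ} (N : ℕ) (ω : ℕ → Site (d + 2)) (j : ℕ) : Prop :=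
  j + 2 ≤ N ∧ ω (j + 2) - ω (j + 1) ≠ ω (j + 1) - ω j

/-- Number of turns of the `N`-step walk `ω` on `ℤ²` (`0 ≤ turns ≤ N - 1`). [cite: MadrasSlade1993, §1.1] -/
def turns (N : ℕ) (ω : ℕ → Site 2) : ℕ := Zd.occ (d := 0) turnAt N ω

/-- The **bending-energy partition function** `Z_N(t) = Σ_{ω ∈ S_N} t^{turns ω}`. [cite: MadrasSlade1993, §1.1] -/
def Zbend (N : ℕ) (t : ℝ) : ℝ := ∑ ω ∈ Zd.saws 2 N, t ^ turns N ω

/-- The bridge edition `Z^B_N(t) = Σ_{ω ∈ B_N} t^{turns ω}`. [cite: MadrasSlade1993, §1.1] -/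
def ZbendB (N : ℕ) (t : ℝ) : ℝ := ∑ ω ∈ Zd.bridges 2 N, t ^ turns N ω

/-- `κ(t) := inf_N log(max(1,t) · Z_{N+1}(t))/(N+1)` (Fekete form: `N ↦ log(max(1,t) Z_N(t))` is
subadditive because concatenation creates at most one turn at the junction). [cite: MadrasSlade1993, §1.1] -/
def bendFE (t : ℝ) : ℝ := ⨅ N : ℕ, Real.log (max 1 t * Zbend (N + 1) t) / ((N : ℝ) + 1)

end Zd

/-! ### Turns read off the step word -/

/-- Number of turns of a step word: positions where consecutive letters differ. [cite: MadrasSlade1993, §1.1] -/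
def wturns : List Step → ℕ
  | a :: b :: w => (if a = b then 0 else 1) + wturns (b :: w)
  | _ => 0

/-- `wturns` of short words. [cite: MadrasSlade1993, §1.1] -/
@[simp] theorem wturns_nil : wturns [] = 0 := rfl

/-- `wturns` of a one-letter word. [cite: MadrasSlade1993, §1.1] -/
@[simp] theorem wturns_singleton (a : Step) : wturns [a] = 0 := rfl

/-- The recursion. [cite: MadrasSlade1993, §1.1] -/
@[simp] theorem wturns_cons_cons (a b : Step) (w : List Step) :
    wturns (a :: b :: w) = (if a = b then 0 else 1) + wturns (b :: w) := rfl

/-- One step into a word: `traj (a :: v) (k+1) = e_a + traj v k`. [cite: MadrasSlade1993, §1.1] -/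
theorem traj_cons_succ (a : Step) (v : List Step) (k : ℕ) : traj (a :: v) (k + 1) = Step.vec a + traj v k := by
  have h := traj_append_right [a] v k
  simpa [Nat.add_comm] using h

/-- `traj (a :: v) 1 = e_a`. [cite: MadrasSlade1993, §1.1] -/
theorem traj_cons_one (a : Step) (v : List Step) : traj (a :: v) 1 = Step.vec a := by
  simpa using traj_cons_succ a v 0

/-- `traj (a :: b :: w) 2 = e_a + e_b`. [cite: MadrasSlade1993, §1.1] -/
theorem traj_cons_two (a b : Step) (w : List Step) : traj (a :: b :: w) 2 = Step.vec a + Step.vec b := by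
  have h := traj_cons_succ a (b :: w) 1
  rw [traj_cons_one] at h
  simpa using h

/-- The turn events of `a :: b :: w` at positive times are the turn events of `b :: w`, shifted. [cite: MadrasSlade1993, §1.1] -/
theorem turnAt_traj_cons_succ (a b : Step) (w : List Step) (j : ℕ) :
    Zd.turnAt ((b :: w).length + 1) (traj (a :: b :: w)) (j + 1) ↔ Zd.turnAt (b :: w).length (traj (b :: w)) j := by
  have e3 : traj (a :: b :: w) (j + 1 + 2) = Step.vec a + traj (b :: w) (j + 2) := traj_cons_succ a (b :: w) (j + 2)
  have e2 : traj (a :: b :: w) (j + 1 + 1) = Step.vec a + traj (b :: w) (j + 1) := traj_cons_succ a (b :: w) (j + 1)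
  have e1 : traj (a :: b :: w) (j + 1) = Step.vec a + traj (b :: w) j := traj_cons_succ a (b :: w) j
  simp only [Zd.turnAt, e1, e2, e3, add_sub_add_left_eq_sub, List.length_cons]
  constructor <;> rintro ⟨h1, h2⟩ <;> exact ⟨by omega, h2⟩

/-- The turn event at time `0` of `a :: b :: w` is `a ≠ b`. [cite: MadrasSlade1993, §1.1] -/
theorem turnAt_traj_zero (a b : Step) (w : List Step) :
    Zd.turnAt ((b :: w).length + 1) (traj (a :: b :: w)) 0 ↔ a ≠ b := by
  simp only [Zd.turnAt, zero_add, traj_cons_two, traj_cons_one, traj_zero, sub_zero, add_sub_cancel_left, ne_eq,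
    List.length_cons]
  constructor
  · rintro ⟨-, h⟩ hab
    exact h (by rw [hab])
  · intro hab
    exact ⟨by omega, fun h => hab (Step.vec_injective h).symm⟩

/-- **Dictionary**: the event count `Zd.occ turnAt` of the trajectory of a word is the number of letter changes of
the word. [cite: MadrasSlade1993, §1.1] -/
theorem occ_turnAt_traj (w : List Step) : Zd.occ (d := 0) Zd.turnAt w.length (traj w) = wturns w := by
  classical
  unfold Zd.occ
  rw [Finset.card_filter]
  induction w with
  | nil => simp [Zd.turnAt]
  | cons a w ih =>
    cases w with
    | nil =>
      simp only [List.length_singleton, wturns_singleton]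
      refine Finset.sum_eq_zero fun j _ => ?_
      rw [if_neg]
      rintro ⟨h, -⟩
      omega
    | cons b w =>
      rw [wturns_cons_cons, ← ih, List.length_cons, Finset.sum_range_succ']
      simp only [turnAt_traj_cons_succ, turnAt_traj_zero]
      by_cases hab : a = b
      · simp [hab]
      · simp [hab, Nat.add_comm]

/-- For a word of length `N`: `turns N (traj w) = wturns w`. [cite: MadrasSlade1993, §1.1] -/
theorem turns_traj {N : ℕ} {w : List Step} (hw : w.length = N) : Zd.turns N (traj w) = wturns w := by
  subst hw; exact occ_turnAt_traj w

/-- **`Z_N(t)` as a sum over self-avoiding words.** [cite: MadrasSlade1993, §1.1] -/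
theorem Zbend_eq_sum_sawWords (N : ℕ) (t : ℝ) : Zd.Zbend N t = ∑ w ∈ sawWords N, t ^ wturns w := by
  classical
  rw [Zd.Zbend, ← image_traj_sawWords, Finset.sum_image]
  · refine Finset.sum_congr rfl fun w hw => ?_
    rw [turns_traj (mem_sawWords.1 hw).1]
  · intro w hw w' hw' h
    exact traj_injOn N (by simp [(mem_sawWords.1 hw).1]) (by simp [(mem_sawWords.1 hw').1]) h

end Literature.Probability.RandomPlanarGeometry.SAW
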